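import Summits.HodgeConjecture.HodgeConjecture.Theorems.Ring2HypothesesWeilComponentsCMLadder
import Literature.AlgebraicGeometry.HodgeTheory.WeilClassesMoonenZarhinCriterionHolds
import HarnessLib

/-!
# Ring 2 — hypotheses layer, part VII-D′: the Moonen–Zarhin binder of part VII-D DISCHARGED by the Literature seat's
theorem `MoonenZarhin1998_weilClasses_hodgeCriterion_holds`; T6(δ)-CM without `HC_CM`

HONEST FRAMING (page 1): research route conditional on HC_CM; not a corollary; Q11.4-sentence-2 already refuted in
dim ≥ 3. `HC_CM` = `Theses.RankFourFaces.CMAbelianHodge` (stmt-HodgeConjecture-3052), a binder BY NAME; no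
internally-minted statement is cited as a fact.

Cell `pub-hodge-ring2`, seat `pub-hodge-ring2-typer2`, gen 8. Part VII-D (`Ring2HypothesesWeilComponentsCMLadder`, rows
T6-CM / T6(δ)-CM for the CM-FIELD components `(E, 2k, δ)`) carried the Moonen–Zarhin 1998 criterion ("`W_E ⊗ ℂ` is of
type `(k,k)` iff the multiplicities balance; else its rational `(k,k)`-classes vanish") as a binder
`(hMZ : MoonenZarhin1998_weilClasses_hodgeCriterion)`. The Literature seat has since PROVED that named statement on the
tree's carriers (`Literature/AlgebraicGeometry/HodgeTheory/WeilClassesMoonenZarhinCriterionHolds.lean`, theorem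
`MoonenZarhin1998_weilClasses_hodgeCriterion_holds`, p190733). This file cites it BY NAME (LEAD rule 7: never
re-derive) and records the rows with one binder fewer; the only remaining print input of the T6(δ)-CM chain besides the
δ-leaves is fact #24 (`Deligne1982_hodgeRing_weilTypeCM_of_hodgeGroupSU`: Deligne 1982 §4 (4.4) for `E` imaginary
quadratic = van Geemen 6.12; for `[E:ℚ] ≥ 4` Milne's re-edition endnote 16, UNREFEREED — unchanged, still a binder).

| row | Lean name | binders left | (c7) KIND of `HC_CM` |
|---|---|---|---|
| T6-CM′ | `hodgeGeneralWeilTypeCMField_of_weilClassesWeilTypeCM_of_deligne` | #24, R3-on-carriers | — |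
| T6(δ)-CM′ | `hodgeGeneralWeilTypeComponentCM_of_weilClassesComponentCM_of_deligne` | #24, W-CM(δ) | — |
| T6(δ)-CM from `HC_CM` | `HC_GeneralWeilTypeComponentCM_of_HC_CM` | `HC_CM`, P-CM(δ), VHC-CM(δ), #24 | NOMINAL via W1-CM (next row removes it) |
| T6(δ)-CM without `HC_CM` | `hodgeGeneralWeilTypeComponentCM_of_divisorGeneratedCMPointed` | divisor-generated P-CM(δ), VHC-CM(δ), #24 | DISCHARGED (divisor-generated CM anchors, row W1′-CM of VII-C) |

HONEST COLUMN: nothing here is a new case of the Hodge conjecture; the δ-leaves `WeilVariationalHodgeComponentCM` (OPEN,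
Weil-confined variational Hodge) and the pointed-family leaves carry all the content; #24 is UNREFEREED for `[E:ℚ] ≥ 4`.
References: [Deligne1982HodgeCycles] §4 (4.4), Prop. 4.4, Lemma 4.6, Thm. 4.8, §5; Milne 2003 re-edition endnote 16;
[MoonenZarhin1998WeilClasses] J. reine angew. Math. 496 (1998) 83–92 (= arXiv:alg-geom/9612017), §1 Criterion; [CharlesSchnell2014Notes] Conj. 11.3.1.
-/

set_option linter.dupNamespace false

noncomputable section

open CategoryTheory
open Literature.AlgebraicGeometry Literature.AlgebraicGeometry.Motives
open Literature.AlgebraicGeometry.HodgeTheory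
open Literature.AlgebraicGeometry.Deligne1982
open Literature.AlgebraicTopology.SingularHomology
open Summit.HodgeConjecture.HodgeConjecture.WeilTypeLadder
open Summit.HodgeConjecture.HodgeConjecture.Theses
open Summit.HodgeConjecture.HodgeConjecture.Ring2Transport

namespace Summit.HodgeConjecture.HodgeConjecture.Ring2.Hypotheses

/-- **T6-CM′ — R3 on Deligne's carriers ⟹ the Hodge conjecture for the general member of CM-field Weil type, granted
fact #24 ONLY** (the Moonen–Zarhin binder of `hodgeGeneralWeilTypeCMField_of_weilClassesWeilTypeCM` discharged by the
Literature theorem `MoonenZarhin1998_weilClasses_hodgeCriterion_holds`).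
[cite: Deligne1982HodgeCycles, §4 (4.4) and Milne 2003 re-edition endnote 16] [cite: MoonenZarhin1998WeilClasses, §1 (Criterion)] -/
theorem hodgeGeneralWeilTypeCMField_of_weilClassesWeilTypeCM_of_deligne
    (h24 : Deligne1982_hodgeRing_weilTypeCM_of_hodgeGroupSU) (h : WeilClassesWeilTypeCM) :
    HodgeGeneralWeilTypeCMField :=
  hodgeGeneralWeilTypeCMField_of_weilClassesWeilTypeCM h24 MoonenZarhin1998_weilClasses_hodgeCriterion_holds h

variable {R : Polynomial ℤ} [Fact (Irreducible (realPolyQ R))] {e₀ k : ℕ} {δ : cmNormResidueGroup R}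

/-- **T6(δ)-CM′ — the component target `WeilClassesComponentCM R e₀ k δ` ⟹ the Hodge conjecture for the general
member of the component, granted #24 ONLY** (MZ discharged). [cite: Deligne1982HodgeCycles, §4 (4.4), Prop. 4.4 and Milne 2003 re-edition endnote 16]
[cite: MoonenZarhin1998WeilClasses, §1 (Criterion)] -/
theorem hodgeGeneralWeilTypeComponentCM_of_weilClassesComponentCM_of_deligne
    (h24 : Deligne1982_hodgeRing_weilTypeCM_of_hodgeGroupSU) (hWδ : WeilClassesComponentCM R e₀ k δ) :
    HodgeGeneralWeilTypeComponentCM R e₀ k δ :=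
  hodgeGeneralWeilTypeComponentCM_of_weilClassesComponentCM h24 MoonenZarhin1998_weilClasses_hodgeCriterion_holds hWδ

/-- **`HC_<general member of the CM-field component (E, 2k, δ)>_of_HC_CM`** — binders: `HC_CM` (BY NAME), the CM-pointed
δ-leaf, the δ-restricted Weil-confined variational Hodge statement, fact #24; Moonen–Zarhin is now a theorem.
(c7) KIND of `HC_CM`: NOMINAL via W1-CM (the next theorem removes it). CONDITIONAL on all four binders.
[cite: Deligne1982HodgeCycles, §4 proof of Thm. 4.8 and (4.4)] [cite: CharlesSchnell2014Notes, Conj. 11.3.1] -/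
theorem HC_GeneralWeilTypeComponentCM_of_HC_CM (hCM : Theses.RankFourFaces.CMAbelianHodge)
    (h24 : Deligne1982_hodgeRing_weilTypeCM_of_hodgeGroupSU) (hP : CMPointedWeilFamiliesComponentCM R e₀ k δ)
    (hV : WeilVariationalHodgeComponentCM R e₀ k δ) : HodgeGeneralWeilTypeComponentCM R e₀ k δ :=
  hodgeGeneralWeilTypeComponentCM_of_HC_CM hCM hP hV h24 MoonenZarhin1998_weilClasses_hodgeCriterion_holds

/-- **T6(δ)-CM WITHOUT `HC_CM`** — from δ-families pointed at a DIVISOR-GENERATED CM fibre (row W1′-CM of part VII-C,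
`weilClassesComponentCM_of_divisorGeneratedCMPointed`), the δ-VHC statement and #24; `HC_CM` DISCHARGED on this chain.
[cite: Deligne1982HodgeCycles, §5 and §4 (4.4)] [cite: CharlesSchnell2014Notes, Conj. 11.3.1] -/
theorem hodgeGeneralWeilTypeComponentCM_of_divisorGeneratedCMPointed
    (h24 : Deligne1982_hodgeRing_weilTypeCM_of_hodgeGroupSU)
    (hP : DivisorGeneratedCMPointedWeilFamiliesComponentCM R e₀ k δ) (hV : WeilVariationalHodgeComponentCM R e₀ k δ) :
    HodgeGeneralWeilTypeComponentCM R e₀ k δ :=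
  hodgeGeneralWeilTypeComponentCM_of_weilClassesComponentCM_of_deligne h24
    (weilClassesComponentCM_of_divisorGeneratedCMPointed hP hV)

end Summit.HodgeConjecture.HodgeConjecture.Ring2.Hypotheses

end
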